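import Mathlib.Analysis.SpecialFunctions.Exp
import Mathlib.Analysis.SpecialFunctions.Pow.Real
import HarnessLib

/-!
# `UV3BranchExpansionCountingRecursion` — (F-C2)-num of the hTop BRANCH (MÖBIUS) EXPANSION: THE K-UNIFORM FIXED POINT OF THE EXPLORATION
# GENERATING FUNCTIONS (crux `UnitScaleTilt.HistoryTailL`, stmt-QuantumFields-19936 — SUPPLY side, record-independent arithmetic)

Cell `ym3-torus` (YM ladder rung R3 = continuum SU(2) Yang–Mills on T³ — a RUNG, NOT d = 4, NOT infinite volume, NOT a mass gap, NOT Clay);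
width seat `ym3-torus-px13` (gen 13), explicit-unit helper; `--supports stmt-QuantumFields-19936 --as helper`.  THEOREMS ONLY (0 `def`, 0 `sorry`,
default heartbeats, Mathlib + HarnessLib imports only).

WHAT.  LEAD ★w1-19936 g12's design note `Cruxes/HistoryTailL/HTopBranchExpansion.md` §5 (C) bounds the live-set sum of the branch expansion by
exploration trees from the top whose generating functions `D_i` (Dist-bond subtrees at level `i`) and `E_i` (element nodes) obey, level by level,
`E_i ≤ x·(1 + D_i)^{r₀}` and `D_{i+1} ≤ E_i + D_i·(D_i + ρ₀·E_i)^{L−1}`, `D_j = 0` (nothing is distorted at the bottom level), with `x = 2K_α p_adm` the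
activity of one constrained switch site, `r₀` the maximal read-set size, `ρ₀` the maximal read multiplicity and `L` the block size.  THIS FILE proves
the K-UNIFORM FIXED POINT of that recursion as pure real arithmetic, the recursion and the smallness of `x` being HYPOTHESES:

* §1 one step: `D ≤ 2x ⇒ E ≤ x(1+η₁)` (`(1+2x)^{r₀} ≤ 1+η₁`), the ghost term `D·(D + ρ₀E)^{L−1} ≤ x·η₂` (`2(2x(1+ρ₀))^{L−1} ≤ η₂`), hence
  `D' ≤ x(1 + η₁ + η₂) ≤ 2x` when `η₁ + η₂ ≤ 1`;
* §2 ★★ `D_le_of_recursion` ∕ `E_le_of_recursion` ∕ `D_le_two_mul_of_recursion`: for every level `i ≥ j`, `D_i ≤ x(1 + η₁ + η₂)` and `E_i ≤ x(1 + η₁)` —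
  uniformly in `i` (no dependence on the number of levels `K − j`);
* §3 the exponential envelope consumed by the assembly (F-TOP): `(1 + D_i)^N ≤ exp(N·x(1 + η₁ + η₂))` (`Real.add_one_le_exp`);
* §4 [folklore] an explicit `η₁`: `0 ≤ t`, `n·t ≤ 1 ⇒ (1 + t)^n ≤ 1 + n·t + (n·t)²` (`(1+t)^n ≤ e^{nt}` and `e^u ≤ 1 + u + u²` on `|u| ≤ 1`), so that
  `η₁ := 2r₀x + (2r₀x)²` serves whenever `2r₀x ≤ 1` (the note's numbers: `x·r₀ ≤ 2.4·10⁻³ ⇒ η₁ ≤ 4.9·10⁻³`; `L = 3`, `ρ₀ ≤ 11`, `x ≤ 1.2·10⁻⁵ ⇒ η₂ ≤ 10⁻⁶`).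

HONEST SCOPE.  Arithmetic of a displayed recursion; the model-specific letters (`r₀`, `ρ₀`, `K_α`, `p_adm`, the read sets, the exploration trees, the
injection of live sets into trees, the covering inequality `Σ_{live} x^{|𝐬|} ≤ (1 + D_K)^N − 1`) are NOT here.  Nothing of hTop, the χ (α) record
`AlphaInputsT3ACv4RecChi`, (O‴χₛ), `HistoryTailL`, the rung R3 is proved; the Yang–Mills mass gap is NOT proved.

References: T. Bałaban, CMP **102** (1985) 255–275 [Balaban1985UV3] ((47), (55) pp.268–270: the averaged densities whose top push-forward hTop serves);
LEAD note `Cruxes/HistoryTailL/HTopBranchExpansion.md` §5–§6 (2026-08-30).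
-/

set_option autoImplicit false

noncomputable section

namespace Summit.QuantumFields.YangMills.Theorems.UV3BranchExpansionCountingRecursion

/-! ## §1 One step of the induction -/

/-- `η₁ ≥ 0` is forced by its defining inequality: `1 ≤ (1 + 2x)^{r₀} ≤ 1 + η₁` for `x ≥ 0`. [folklore] -/
theorem eta1_nonneg {x η₁ : ℝ} {r₀ : ℕ} (hx : 0 ≤ x) (hη₁ : (1 + 2 * x) ^ r₀ ≤ 1 + η₁) : 0 ≤ η₁ := by
  have h1 : (1 : ℝ) ≤ (1 + 2 * x) ^ r₀ := one_le_pow₀ (by linarith)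
  linarith

/-- `η₂ ≥ 0` is forced by its defining inequality: `0 ≤ 2·(2x(1+ρ₀))^{L−1} ≤ η₂` for `x ≥ 0`. [folklore] -/
theorem eta2_nonneg {x η₂ : ℝ} {ρ₀ L : ℕ} (hx : 0 ≤ x) (hη₂ : 2 * (2 * x * (1 + (ρ₀ : ℝ))) ^ (L - 1) ≤ η₂) : 0 ≤ η₂ :=
  le_trans (by positivity) hη₂

/-- **THE ELEMENT NODES**: if `D ≤ 2x` then `E ≤ x·(1 + D)^{r₀} ≤ x·(1 + 2x)^{r₀} ≤ x·(1 + η₁)`. [folklore] -/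
theorem E_le_of_D_le {x η₁ D E : ℝ} {r₀ : ℕ} (hx : 0 ≤ x) (hD0 : 0 ≤ D) (hDle : D ≤ 2 * x)
    (hE : E ≤ x * (1 + D) ^ r₀) (hη₁ : (1 + 2 * x) ^ r₀ ≤ 1 + η₁) : E ≤ x * (1 + η₁) := by
  have hpow : (1 + D) ^ r₀ ≤ (1 + 2 * x) ^ r₀ :=
    pow_le_pow_left₀ (by linarith) (by linarith) r₀
  calc E ≤ x * (1 + D) ^ r₀ := hE
    _ ≤ x * (1 + 2 * x) ^ r₀ := mul_le_mul_of_nonneg_left hpow hx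
    _ ≤ x * (1 + η₁) := mul_le_mul_of_nonneg_left hη₁ hx

/-- **THE GHOST TERM**: if `D ≤ 2x`, `E ≤ x(1 + η₁)` with `η₁ ≤ 1`, then `D·(D + ρ₀E)^{L−1} ≤ 2x·(2x(1 + ρ₀))^{L−1} ≤ x·η₂`
(the crossing slot of a ghost bond is distorted, its `L − 1` side slots distorted or read). [folklore] -/
theorem ghost_le_of_D_le {x η₁ η₂ D E : ℝ} {ρ₀ L : ℕ} (hx : 0 ≤ x) (hD0 : 0 ≤ D) (hE0 : 0 ≤ E) (hDle : D ≤ 2 * x)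
    (hEle : E ≤ x * (1 + η₁)) (hη₁ : η₁ ≤ 1) (hη₂ : 2 * (2 * x * (1 + (ρ₀ : ℝ))) ^ (L - 1) ≤ η₂) :
    D * (D + (ρ₀ : ℝ) * E) ^ (L - 1) ≤ x * η₂ := by
  have hρ : (0 : ℝ) ≤ (ρ₀ : ℝ) := Nat.cast_nonneg ρ₀
  have hE2 : E ≤ 2 * x := by nlinarith
  have hbase : D + (ρ₀ : ℝ) * E ≤ 2 * x * (1 + (ρ₀ : ℝ)) := by nlinarith
  have hbase0 : 0 ≤ D + (ρ₀ : ℝ) * E := by positivity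
  have hpow : (D + (ρ₀ : ℝ) * E) ^ (L - 1) ≤ (2 * x * (1 + (ρ₀ : ℝ))) ^ (L - 1) :=
    pow_le_pow_left₀ hbase0 hbase (L - 1)
  have hpow0 : 0 ≤ (2 * x * (1 + (ρ₀ : ℝ))) ^ (L - 1) := by positivity
  calc D * (D + (ρ₀ : ℝ) * E) ^ (L - 1)
      ≤ (2 * x) * (2 * x * (1 + (ρ₀ : ℝ))) ^ (L - 1) :=
        mul_le_mul hDle hpow (by positivity) (by positivity)
    _ = x * (2 * (2 * x * (1 + (ρ₀ : ℝ))) ^ (L - 1)) := by ring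
    _ ≤ x * η₂ := mul_le_mul_of_nonneg_left hη₂ hx

/-- **ONE LEVEL UP**: `D ≤ 2x` and the recursion `D' ≤ E + D·(D + ρ₀E)^{L−1}`, `E ≤ x(1 + D)^{r₀}` give `D' ≤ x·(1 + η₁ + η₂)` — and this is `≤ 2x` again
when `η₁ + η₂ ≤ 1`, which closes the induction. [folklore] -/
theorem D_succ_le_of_D_le {x η₁ η₂ D D' E : ℝ} {r₀ ρ₀ L : ℕ} (hx : 0 ≤ x) (hD0 : 0 ≤ D) (hE0 : 0 ≤ E) (hDle : D ≤ 2 * x)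
    (hE : E ≤ x * (1 + D) ^ r₀) (hD' : D' ≤ E + D * (D + (ρ₀ : ℝ) * E) ^ (L - 1))
    (hη₁ : (1 + 2 * x) ^ r₀ ≤ 1 + η₁) (hη₂ : 2 * (2 * x * (1 + (ρ₀ : ℝ))) ^ (L - 1) ≤ η₂) (hη : η₁ + η₂ ≤ 1) :
    D' ≤ x * (1 + η₁ + η₂) := by
  have hη₁le : η₁ ≤ 1 := by linarith [eta2_nonneg hx hη₂]
  have hEle : E ≤ x * (1 + η₁) := E_le_of_D_le hx hD0 hDle hE hη₁
  have hghost : D * (D + (ρ₀ : ℝ) * E) ^ (L - 1) ≤ x * η₂ := ghost_le_of_D_le hx hD0 hE0 hDle hEle hη₁le hη₂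
  calc D' ≤ E + D * (D + (ρ₀ : ℝ) * E) ^ (L - 1) := hD'
    _ ≤ x * (1 + η₁) + x * η₂ := add_le_add hEle hghost
    _ = x * (1 + η₁ + η₂) := by ring

/-- The envelope `x·(1 + η₁ + η₂) ≤ 2x` under `η₁ + η₂ ≤ 1`, `x ≥ 0`. [folklore] -/
theorem mul_one_add_eta_le_two_mul {x η₁ η₂ : ℝ} (hx : 0 ≤ x) (hη : η₁ + η₂ ≤ 1) : x * (1 + η₁ + η₂) ≤ 2 * x := by nlinarith

/-! ## §2 The K-uniform fixed point: every level `i ≥ j` -/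

section Recursion

variable {x η₁ η₂ : ℝ} {r₀ ρ₀ L j : ℕ} {D E : ℕ → ℝ}

/-- ★★ **THE K-UNIFORM FIXED POINT (invariant form)**: under the exploration recursion `E_i ≤ x(1 + D_i)^{r₀}`, `D_{i+1} ≤ E_i + D_i(D_i + ρ₀E_i)^{L−1}`,
`D_j = 0`, `D_i, E_i ≥ 0`, and the smallness `(1 + 2x)^{r₀} ≤ 1 + η₁`, `2(2x(1 + ρ₀))^{L−1} ≤ η₂`, `η₁ + η₂ ≤ 1`: `D_i ≤ 2x` at EVERY level `i ≥ j` — the bound does not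
depend on how many levels have been climbed. [folklore] -/
theorem D_le_two_mul_of_recursion (hx : 0 ≤ x) (hD0 : ∀ i, 0 ≤ D i) (hE0 : ∀ i, 0 ≤ E i)
    (hE : ∀ i, E i ≤ x * (1 + D i) ^ r₀) (hD : ∀ i, D (i + 1) ≤ E i + D i * (D i + (ρ₀ : ℝ) * E i) ^ (L - 1)) (hDj : D j = 0)
    (hη₁ : (1 + 2 * x) ^ r₀ ≤ 1 + η₁) (hη₂ : 2 * (2 * x * (1 + (ρ₀ : ℝ))) ^ (L - 1) ≤ η₂) (hη : η₁ + η₂ ≤ 1) :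
    ∀ i, j ≤ i → D i ≤ 2 * x := by
  intro i hi
  induction i, hi using Nat.le_induction with
  | base => rw [hDj]; positivity
  | succ k hk ih =>
    exact (D_succ_le_of_D_le hx (hD0 k) (hE0 k) ih (hE k) (hD k) hη₁ hη₂ hη).trans (mul_one_add_eta_le_two_mul hx hη)

/-- ★★ **THE K-UNIFORM FIXED POINT (sharp form)**: under the same hypotheses, `D_i ≤ x·(1 + η₁ + η₂)` at every level `i ≥ j`
(the note's `D_* ≤ x(1 + 10⁻²)` at `L = 3`, `x·r₀ ≤ 2.4·10⁻³`, `ρ₀ ≤ 11`). [folklore] -/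
theorem D_le_of_recursion (hx : 0 ≤ x) (hD0 : ∀ i, 0 ≤ D i) (hE0 : ∀ i, 0 ≤ E i)
    (hE : ∀ i, E i ≤ x * (1 + D i) ^ r₀) (hD : ∀ i, D (i + 1) ≤ E i + D i * (D i + (ρ₀ : ℝ) * E i) ^ (L - 1)) (hDj : D j = 0)
    (hη₁ : (1 + 2 * x) ^ r₀ ≤ 1 + η₁) (hη₂ : 2 * (2 * x * (1 + (ρ₀ : ℝ))) ^ (L - 1) ≤ η₂) (hη : η₁ + η₂ ≤ 1) :
    ∀ i, j ≤ i → D i ≤ x * (1 + η₁ + η₂) := by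
  intro i hi
  rcases Nat.eq_or_lt_of_le hi with rfl | hlt
  · rw [hDj]
    have := eta1_nonneg hx hη₁
    have := eta2_nonneg hx hη₂
    positivity
  · obtain ⟨k, rfl⟩ : ∃ k, i = k + 1 := ⟨i - 1, by omega⟩
    have hjk : j ≤ k := by omega
    exact D_succ_le_of_D_le hx (hD0 k) (hE0 k) (D_le_two_mul_of_recursion hx hD0 hE0 hE hD hDj hη₁ hη₂ hη k hjk)
      (hE k) (hD k) hη₁ hη₂ hη

/-- ★ **THE ELEMENT GENERATING FUNCTIONS ARE K-UNIFORMLY SMALL**: `E_i ≤ x·(1 + η₁)` at every level `i ≥ j`. [folklore] -/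
theorem E_le_of_recursion (hx : 0 ≤ x) (hD0 : ∀ i, 0 ≤ D i) (hE0 : ∀ i, 0 ≤ E i)
    (hE : ∀ i, E i ≤ x * (1 + D i) ^ r₀) (hD : ∀ i, D (i + 1) ≤ E i + D i * (D i + (ρ₀ : ℝ) * E i) ^ (L - 1)) (hDj : D j = 0)
    (hη₁ : (1 + 2 * x) ^ r₀ ≤ 1 + η₁) (hη₂ : 2 * (2 * x * (1 + (ρ₀ : ℝ))) ^ (L - 1) ≤ η₂) (hη : η₁ + η₂ ≤ 1) :
    ∀ i, j ≤ i → E i ≤ x * (1 + η₁) := fun i hi =>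
  E_le_of_D_le hx (hD0 i) (D_le_two_mul_of_recursion hx hD0 hE0 hE hD hDj hη₁ hη₂ hη i hi) (hE i) hη₁

end Recursion

/-! ## §3 The exponential envelope the assembly consumes -/

/-- `(1 + D)^N ≤ exp(N·D)` for `D ≥ 0` (`1 + D ≤ e^{D}`). [folklore] -/
theorem one_add_pow_le_exp_mul {D : ℝ} (hD : 0 ≤ D) (N : ℕ) : (1 + D) ^ N ≤ Real.exp ((N : ℝ) * D) := by
  have h1 : 1 + D ≤ Real.exp D := by linarith [Real.add_one_le_exp D]
  calc (1 + D) ^ N ≤ (Real.exp D) ^ N := pow_le_pow_left₀ (by linarith) h1 N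
    _ = Real.exp ((N : ℝ) * D) := by rw [← Real.exp_nat_mul]

/-- ★ **THE TOP ENVELOPE**: under the recursion and smallness hypotheses of §2, `(1 + D_i)^N ≤ exp(N·x·(1 + η₁ + η₂))` at every level `i ≥ j` and for every
`N` (read at `i = K`, `N = #PBond(K)`: the hTop constant `c = #PBond(K)·x(1 + η₁ + η₂)`, K- and j-free). [folklore] -/
theorem one_add_D_pow_le_exp_of_recursion {x η₁ η₂ : ℝ} {r₀ ρ₀ L j : ℕ} {D E : ℕ → ℝ}
    (hx : 0 ≤ x) (hD0 : ∀ i, 0 ≤ D i) (hE0 : ∀ i, 0 ≤ E i)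
    (hE : ∀ i, E i ≤ x * (1 + D i) ^ r₀) (hD : ∀ i, D (i + 1) ≤ E i + D i * (D i + (ρ₀ : ℝ) * E i) ^ (L - 1)) (hDj : D j = 0)
    (hη₁ : (1 + 2 * x) ^ r₀ ≤ 1 + η₁) (hη₂ : 2 * (2 * x * (1 + (ρ₀ : ℝ))) ^ (L - 1) ≤ η₂) (hη : η₁ + η₂ ≤ 1)
    (i : ℕ) (hi : j ≤ i) (N : ℕ) :
    (1 + D i) ^ N ≤ Real.exp ((N : ℝ) * (x * (1 + η₁ + η₂))) := by
  refine (one_add_pow_le_exp_mul (hD0 i) N).trans ?_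
  rw [Real.exp_le_exp]
  exact mul_le_mul_of_nonneg_left (D_le_of_recursion hx hD0 hE0 hE hD hDj hη₁ hη₂ hη i hi) (Nat.cast_nonneg N)

/-! ## §4 [folklore] an explicit `η₁` -/

/-- **BERNOULLI FROM ABOVE**: `0 ≤ t`, `n·t ≤ 1 ⇒ (1 + t)^n ≤ 1 + n·t + (n·t)²` (`(1+t)^n ≤ e^{nt}` and `e^u ≤ 1 + u + u²` on `|u| ≤ 1`, Mathlib
`Real.abs_exp_sub_one_sub_id_le`; cf. lit `Barriers.MatrixMultiplication.exp_le_one_add_add_sq`, not imported here to keep the import cone Mathlib-only) — so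
`η₁ := 2r₀x + (2r₀x)²` satisfies `(1 + 2x)^{r₀} ≤ 1 + η₁` whenever `2r₀x ≤ 1`. [folklore] -/
theorem one_add_pow_le_one_add_mul_add_sq {t : ℝ} {n : ℕ} (ht : 0 ≤ t) (hnt : (n : ℝ) * t ≤ 1) :
    (1 + t) ^ n ≤ 1 + (n : ℝ) * t + ((n : ℝ) * t) ^ 2 := by
  have hu : |(n : ℝ) * t| ≤ 1 := by
    rw [abs_of_nonneg (by positivity)]; exact hnt
  have h := (abs_le.mp (Real.abs_exp_sub_one_sub_id_le hu)).2
  refine (one_add_pow_le_exp_mul ht n).trans ?_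
  linarith

/-- **THE `η₁` ROW IN THE NOTE's LETTERS**: `0 ≤ x`, `2r₀x ≤ 1 ⇒ (1 + 2x)^{r₀} ≤ 1 + (2r₀x + (2r₀x)²)`. [folklore] -/
theorem one_add_two_mul_pow_le {x : ℝ} {r₀ : ℕ} (hx : 0 ≤ x) (h : 2 * (r₀ : ℝ) * x ≤ 1) :
    (1 + 2 * x) ^ r₀ ≤ 1 + (2 * (r₀ : ℝ) * x + (2 * (r₀ : ℝ) * x) ^ 2) := by
  have h1 : (r₀ : ℝ) * (2 * x) ≤ 1 := by linarith
  have h2 := one_add_pow_le_one_add_mul_add_sq (t := 2 * x) (n := r₀) (by linarith) h1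
  have e : (r₀ : ℝ) * (2 * x) = 2 * (r₀ : ℝ) * x := by ring
  rw [e] at h2
  linarith [h2]

/-! ## §5 (v1.1 APPEND) The fixed point in MULTIPLIER FORM — ghost row `D_{i+1} ≤ E_i + D_i·G_i` with a contraction `G_i ≤ θ < 1`

When readers are SHARED between ghosts (one read set serves the side bonds of up to `ρ₁` coarse lines), the first-discovery tree of a live set has EMPTY side
slots at ghost nodes; admitting `∅` on the side menus and charging every ghost node an amortised weight `z = x^{(1−a)/(ρ₁+1)}` (ghost census: `#ghosts ≤ (ρ₁+1)·|𝐬|`)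
turns §5 (C)'s ghost row into `D_{i+1} ≤ E_i + D_i·G_i`, `G_i = z·(1 + D_i + ρ₀E_i)^{L−1} ≤ θ < 1`, with fixed point `D_* = E_*/(1 − θ)` — K- and j-free.  The rows are HYPOTHESES
here (conditional on the invariant `D_i ≤ x·M`); nothing model-specific is asserted. -/

section Multiplier

variable {x M θ : ℝ} {j : ℕ} {D E G : ℕ → ℝ}

/-- **ONE LEVEL UP, MULTIPLIER FORM**: if `D ≤ x·M`, `E ≤ x·e₁` and the ghost multiplier `G ≤ θ` with `e₁ + θ·M ≤ M` (i.e. `M ≥ e₁/(1−θ)`), then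
`D' ≤ E + D·G ≤ x·M` — the invariant of the amortised recursion. [folklore] -/
theorem D_succ_le_of_multiplier {D D' E G e₁ : ℝ} (hx : 0 ≤ x) (hD0 : 0 ≤ D) (hG0 : 0 ≤ G) (hDle : D ≤ x * M)
    (hEle : E ≤ x * e₁) (hGle : G ≤ θ) (hD' : D' ≤ E + D * G) (hM : e₁ + θ * M ≤ M) :
    D' ≤ x * M := by
  have hθ0 : 0 ≤ θ := hG0.trans hGle
  have h1 : D * G ≤ x * M * θ := mul_le_mul hDle hGle hG0 (by nlinarith)
  nlinarith

/-- ★★ **THE K-UNIFORM FIXED POINT, MULTIPLIER FORM**: under `D_{i+1} ≤ E_i + D_i·G_i`, `D_j = 0`, `D_i, G_i ≥ 0`, and the CONDITIONAL rows «`D_i ≤ x·M ⇒ E_i ≤ x·e₁`»,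
«`D_i ≤ x·M ⇒ G_i ≤ θ`» with `θ < 1`, `e₁ + θ·M ≤ M` (`0 ≤ e₁`), every level `i ≥ j` has `D_i ≤ x·M` — the fixed point `D_* = E_*/(1 − θ)` of the amortised ghost row
(ghost nodes of weight `z`, empty side slots allowed: `G_i = z·(1 + D_i + ρ₀E_i)^{L−1}`), K- and j-free. [folklore] -/
theorem D_le_of_multiplier_recursion {e₁ : ℝ} (hx : 0 ≤ x) (he₁ : 0 ≤ e₁) (hθ : θ < 1) (hD0 : ∀ i, 0 ≤ D i) (hG0 : ∀ i, 0 ≤ G i)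
    (hE : ∀ i, D i ≤ x * M → E i ≤ x * e₁) (hG : ∀ i, D i ≤ x * M → G i ≤ θ)
    (hD : ∀ i, D (i + 1) ≤ E i + D i * G i) (hDj : D j = 0) (hM : e₁ + θ * M ≤ M) :
    ∀ i, j ≤ i → D i ≤ x * M := by
  have hM0 : 0 ≤ M := by nlinarith
  intro i hi
  induction i, hi using Nat.le_induction with
  | base => rw [hDj]; exact mul_nonneg hx hM0
  | succ k hk ih =>
    exact D_succ_le_of_multiplier hx (hD0 k) (hG0 k) ih (hE k ih) (hG k ih) (hD k) hM

/-- ★ **THE ELEMENT ROW UNDER THE MULTIPLIER FIXED POINT**: `E_i ≤ x·e₁` at every level `i ≥ j`. [folklore] -/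
theorem E_le_of_multiplier_recursion {e₁ : ℝ} (hx : 0 ≤ x) (he₁ : 0 ≤ e₁) (hθ : θ < 1) (hD0 : ∀ i, 0 ≤ D i) (hG0 : ∀ i, 0 ≤ G i)
    (hE : ∀ i, D i ≤ x * M → E i ≤ x * e₁) (hG : ∀ i, D i ≤ x * M → G i ≤ θ)
    (hD : ∀ i, D (i + 1) ≤ E i + D i * G i) (hDj : D j = 0) (hM : e₁ + θ * M ≤ M) :
    ∀ i, j ≤ i → E i ≤ x * e₁ := fun i hi =>
  hE i (D_le_of_multiplier_recursion hx he₁ hθ hD0 hG0 hE hG hD hDj hM i hi)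

/-- **THE CANONICAL CHOICE `M = e₁/(1 − θ)`** satisfies `e₁ + θ·M ≤ M` (with equality) for `θ < 1`. [folklore] -/
theorem e1_add_theta_mul_le (e₁ : ℝ) (hθ : θ < 1) : e₁ + θ * (e₁ / (1 - θ)) ≤ e₁ / (1 - θ) := by
  have h1 : 0 < 1 - θ := by linarith
  rw [div_eq_mul_inv]
  have : e₁ + θ * (e₁ * (1 - θ)⁻¹) = e₁ * (1 - θ)⁻¹ := by
    field_simp
    ring
  rw [this]

end Multiplier

/-! ## §6 (v1.2 APPEND) The closed-form instance for the amortised covering step (C′) of record: `E = x'(1+D)^{r₀}`, `G = (y+D)^{L−1}·(1 + E∕y)^{m}`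

LEAD RULING #51 (2026-08-30 03:42Z): the count of §5 (C) is (C′) — w2-19936 g17's amortised covering, whose one-level transfer ✓`UV3BranchExpansionCountingAmortizedStep.sum_step_le_pow`
and n-level sum ✓`UV3BranchExpansionCountingAmortized.sum_pow_card_le_of_discoverable` take an envelope sequence `D` with
`hstep : x'(1 + D i)^{r₀} + D i·(y + D i)^{L−1}·(1 + x'∕y·(1 + D i)^{r₀})^{(L−1)ρ₀} ≤ D (i+1)`, `x' = x∕y^{s₀}`.  This section PRODUCES such an envelope with a
LEVEL-FREE bound from two explicit smallness inequalities (numerals belong in the memo: at the note's `x = 1.2·10⁻⁵`, `y = 0.9`, `s₀ = 10`, `r₀ = 162`, `ρ₀ = 11`,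
`L = 3`, `θ₀ = 0.85` both hold with room).  Pure arithmetic; nothing model-specific. -/

section Amortised

variable {x' y θ₀ : ℝ} {r₀ L m j : ℕ} {D : ℕ → ℝ}

/-- The element row of (C′) is monotone in `D ≥ 0`: `D ≤ D₁ ⇒ x'(1+D)^{r₀} ≤ x'(1+D₁)^{r₀}` (`x' ≥ 0`). [folklore] -/
theorem amortisedE_mono (hx : 0 ≤ x') {D₀ D₁ : ℝ} (hD₀ : 0 ≤ D₀) (hle : D₀ ≤ D₁) :
    x' * (1 + D₀) ^ r₀ ≤ x' * (1 + D₁) ^ r₀ :=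
  mul_le_mul_of_nonneg_left (pow_le_pow_left₀ (by linarith) (by linarith) r₀) hx

/-- The ghost multiplier of (C′) is monotone in `D ≥ 0`: `D ≤ D₁ ⇒ (y+D)^{L−1}(1 + x'(1+D)^{r₀}∕y)^{m} ≤ (y+D₁)^{L−1}(1 + x'(1+D₁)^{r₀}∕y)^{m}`
(`x' ≥ 0`, `y > 0`). [folklore] -/
theorem amortisedG_mono (hx : 0 ≤ x') (hy : 0 < y) {D₀ D₁ : ℝ} (hD₀ : 0 ≤ D₀) (hle : D₀ ≤ D₁) :
    (y + D₀) ^ (L - 1) * (1 + x' * (1 + D₀) ^ r₀ / y) ^ m ≤ (y + D₁) ^ (L - 1) * (1 + x' * (1 + D₁) ^ r₀ / y) ^ m := by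
  have hE := amortisedE_mono (r₀ := r₀) hx hD₀ hle
  have h1 : (y + D₀) ^ (L - 1) ≤ (y + D₁) ^ (L - 1) := pow_le_pow_left₀ (by linarith) (by linarith) _
  have hq0 : 0 ≤ x' * (1 + D₀) ^ r₀ / y := div_nonneg (mul_nonneg hx (pow_nonneg (by linarith) _)) hy.le
  have h2 : (1 + x' * (1 + D₀) ^ r₀ / y) ^ m ≤ (1 + x' * (1 + D₁) ^ r₀ / y) ^ m :=
    pow_le_pow_left₀ (by linarith) (by linarith [div_le_div_of_nonneg_right hE hy.le]) m
  exact mul_le_mul h1 h2 (pow_nonneg (by linarith) _) (pow_nonneg (by linarith) _)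

/-- ★★ **THE CLOSED-FORM FIXED POINT FOR (C′)**: let `D_{i+1} ≤ E_i + D_i·G_i` with the amortised covering step's letters `E_i = x'(1+D_i)^{r₀}`,
`G_i = (y + D_i)^{L−1}·(1 + E_i∕y)^{m}` (`m = (L−1)ρ₀`), `D_j = 0`, `D_i ≥ 0`, `x' ≥ 0`, `y > 0`.  Fix any `θ₀ < 1` and put `M₀ := 2∕(1 − θ₀)`.  If the two explicit
smallness inequalities `(1 + M₀x')^{r₀} ≤ 2` and `(y + M₀x')^{L−1}·(1 + 2x'∕y)^{m} ≤ θ₀` hold, then `D_i ≤ M₀·x'` at EVERY level `i ≥ j` — K- and j-free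
(§5 `D_le_of_multiplier_recursion` with `e₁ = 2`, `θ = θ₀`, `M = M₀`; the conditional rows by monotonicity in `D`). [folklore] -/
theorem D_le_of_amortised_rows (hx : 0 ≤ x') (hy : 0 < y) (hθ₀ : θ₀ < 1) (hD0 : ∀ i, 0 ≤ D i)
    (hD : ∀ i, D (i + 1) ≤ x' * (1 + D i) ^ r₀ + D i * ((y + D i) ^ (L - 1) * (1 + x' * (1 + D i) ^ r₀ / y) ^ m))
    (hDj : D j = 0)
    (hsmallE : (1 + 2 / (1 - θ₀) * x') ^ r₀ ≤ 2)
    (hsmallG : (y + 2 / (1 - θ₀) * x') ^ (L - 1) * (1 + 2 * x' / y) ^ m ≤ θ₀) :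
    ∀ i, j ≤ i → D i ≤ x' * (2 / (1 - θ₀)) := by
  have h1θ : 0 < 1 - θ₀ := by linarith
  have hM0 : 0 ≤ 2 / (1 - θ₀) := div_nonneg (by norm_num) h1θ.le
  -- the conditional rows
  have hE : ∀ i, D i ≤ x' * (2 / (1 - θ₀)) → x' * (1 + D i) ^ r₀ ≤ x' * 2 := by
    intro i hi
    have hmono := amortisedE_mono (r₀ := r₀) hx (hD0 i) hi
    have : x' * (1 + x' * (2 / (1 - θ₀))) ^ r₀ ≤ x' * 2 := by
      have e : x' * (2 / (1 - θ₀)) = 2 / (1 - θ₀) * x' := by ring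
      rw [e]; exact mul_le_mul_of_nonneg_left hsmallE hx
    exact hmono.trans this
  have hG : ∀ i, D i ≤ x' * (2 / (1 - θ₀)) →
      (y + D i) ^ (L - 1) * (1 + x' * (1 + D i) ^ r₀ / y) ^ m ≤ θ₀ := by
    intro i hi
    have hmono := amortisedG_mono (r₀ := r₀) (L := L) (m := m) hx hy (hD0 i) hi
    refine hmono.trans ?_
    have hEtop : x' * (1 + x' * (2 / (1 - θ₀))) ^ r₀ ≤ x' * 2 := by
      have e : x' * (2 / (1 - θ₀)) = 2 / (1 - θ₀) * x' := by ring
      rw [e]; exact mul_le_mul_of_nonneg_left hsmallE hx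
    have hq : 1 + x' * (1 + x' * (2 / (1 - θ₀))) ^ r₀ / y ≤ 1 + 2 * x' / y := by
      have := div_le_div_of_nonneg_right hEtop hy.le
      have e : x' * 2 / y = 2 * x' / y := by ring
      linarith [e.symm.le, e.le]
    have hq0 : 0 ≤ 1 + x' * (1 + x' * (2 / (1 - θ₀))) ^ r₀ / y := by
      have : 0 ≤ x' * (1 + x' * (2 / (1 - θ₀))) ^ r₀ / y :=
        div_nonneg (mul_nonneg hx (pow_nonneg (by nlinarith [mul_nonneg hx hM0]) _)) hy.le
      linarith
    have e2 : y + x' * (2 / (1 - θ₀)) = y + 2 / (1 - θ₀) * x' := by ring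
    calc (y + x' * (2 / (1 - θ₀))) ^ (L - 1) * (1 + x' * (1 + x' * (2 / (1 - θ₀))) ^ r₀ / y) ^ m
        ≤ (y + x' * (2 / (1 - θ₀))) ^ (L - 1) * (1 + 2 * x' / y) ^ m :=
          mul_le_mul_of_nonneg_left (pow_le_pow_left₀ hq0 hq m) (pow_nonneg (by nlinarith [mul_nonneg hx hM0]) _)
      _ ≤ θ₀ := by rw [e2]; exact hsmallG
  have hM : (2 : ℝ) + θ₀ * (2 / (1 - θ₀)) ≤ 2 / (1 - θ₀) := by
    rw [show (2 : ℝ) + θ₀ * (2 / (1 - θ₀)) = 2 / (1 - θ₀) by field_simp; ring]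
  exact D_le_of_multiplier_recursion (E := fun i => x' * (1 + D i) ^ r₀)
    (G := fun i => (y + D i) ^ (L - 1) * (1 + x' * (1 + D i) ^ r₀ / y) ^ m)
    hx (by norm_num) hθ₀ hD0
    (fun i => by
      have h1 := hD0 i
      exact mul_nonneg (pow_nonneg (by linarith) _) (pow_nonneg (by positivity) _))
    hE hG hD hDj hM

/-- ★ Under the same hypotheses the element row is K-uniformly small: `x'(1 + D_i)^{r₀} ≤ 2x'` at every level `i ≥ j`. [folklore] -/
theorem E_le_of_amortised_rows (hx : 0 ≤ x') (hy : 0 < y) (hθ₀ : θ₀ < 1) (hD0 : ∀ i, 0 ≤ D i)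
    (hD : ∀ i, D (i + 1) ≤ x' * (1 + D i) ^ r₀ + D i * ((y + D i) ^ (L - 1) * (1 + x' * (1 + D i) ^ r₀ / y) ^ m))
    (hDj : D j = 0)
    (hsmallE : (1 + 2 / (1 - θ₀) * x') ^ r₀ ≤ 2)
    (hsmallG : (y + 2 / (1 - θ₀) * x') ^ (L - 1) * (1 + 2 * x' / y) ^ m ≤ θ₀) :
    ∀ i, j ≤ i → x' * (1 + D i) ^ r₀ ≤ 2 * x' := by
  intro i hi
  have hDi := D_le_of_amortised_rows hx hy hθ₀ hD0 hD hDj hsmallE hsmallG i hi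
  have hmono := amortisedE_mono (r₀ := r₀) hx (hD0 i) hDi
  have e : x' * (2 / (1 - θ₀)) = 2 / (1 - θ₀) * x' := by ring
  rw [e] at hmono
  calc x' * (1 + D i) ^ r₀ ≤ x' * (1 + 2 / (1 - θ₀) * x') ^ r₀ := hmono
    _ ≤ x' * 2 := mul_le_mul_of_nonneg_left hsmallE hx
    _ = 2 * x' := by ring

end Amortised

section Envelope

variable {x y θ₀ : ℝ} {r₀ L ρ₀ s₀ : ℕ}

/-- ★★★ **THE K-UNIFORM ENVELOPE FOR THE AMORTISED COUNT, IN (C′)'s LETTERS** (the `hstep`∕`hD` inputs of ✓`UV3BranchExpansionCountingAmortized.sum_pow_card_le_of_discoverable`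
together with a LEVEL-FREE bound): for `x ≥ 0`, `0 < y`, any `θ₀ < 1`, with `x' := x ∕ y^{s₀}` and `M₀ := 2∕(1 − θ₀)`, the two explicit smallness inequalities
`(1 + M₀x')^{r₀} ≤ 2` and `(y + M₀x')^{L−1}·(1 + 2x'∕y)^{(L−1)ρ₀} ≤ θ₀` give a sequence `D : ℕ → ℝ` with `0 ≤ D i`,
`x'(1 + D i)^{r₀} + D i·(y + D i)^{L−1}·(1 + x'∕y·(1 + D i)^{r₀})^{(L−1)ρ₀} ≤ D (i+1)` (token shape of (M2)'s `hstep`, here with equality) and **`D i ≤ M₀·x'` for EVERY `i`**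
— so `(1 + D n)^{#β n} ≤ exp(#β n · M₀ x')` uniformly in the number of levels `n`. [folklore] -/
theorem exists_amortised_envelope (hx : 0 ≤ x) (hy : 0 < y) (hθ₀ : θ₀ < 1)
    (hsmallE : (1 + 2 / (1 - θ₀) * (x / y ^ s₀)) ^ r₀ ≤ 2)
    (hsmallG : (y + 2 / (1 - θ₀) * (x / y ^ s₀)) ^ (L - 1) * (1 + 2 * (x / y ^ s₀) / y) ^ ((L - 1) * ρ₀) ≤ θ₀) :
    ∃ D : ℕ → ℝ, (∀ i, 0 ≤ D i) ∧ D 0 = 0 ∧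
      (∀ i, x / y ^ s₀ * (1 + D i) ^ r₀ +
          D i * (y + D i) ^ (L - 1) * (1 + x / y ^ s₀ / y * (1 + D i) ^ r₀) ^ ((L - 1) * ρ₀) ≤ D (i + 1)) ∧
      ∀ i, D i ≤ 2 / (1 - θ₀) * (x / y ^ s₀) := by
  set x' : ℝ := x / y ^ s₀ with hx'
  have hx'0 : 0 ≤ x' := div_nonneg hx (pow_nonneg hy.le _)
  -- the envelope: the recursion with equality
  let step : ℝ → ℝ := fun d =>
    x' * (1 + d) ^ r₀ + d * ((y + d) ^ (L - 1) * (1 + x' * (1 + d) ^ r₀ / y) ^ ((L - 1) * ρ₀))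
  let D : ℕ → ℝ := fun i => Nat.rec 0 (fun _ d => step d) i
  have hD0 : D 0 = 0 := rfl
  have hDs : ∀ i, D (i + 1) = step (D i) := fun i => rfl
  have hDnn : ∀ i, 0 ≤ D i := by
    intro i
    induction i with
    | zero => exact le_of_eq hD0.symm
    | succ k ih =>
      rw [hDs]
      have h1 : 0 ≤ (1 + x' * (1 + D k) ^ r₀ / y) := by positivity
      positivity
  refine ⟨D, hDnn, hD0, fun i => ?_, fun i => ?_⟩
  · rw [hDs]
    have e : x' / y * (1 + D i) ^ r₀ = x' * (1 + D i) ^ r₀ / y := by ring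
    rw [e]
    exact le_of_eq (by ring)
  · have h := D_le_of_amortised_rows (x' := x') (y := y) (θ₀ := θ₀) (r₀ := r₀) (L := L) (m := (L - 1) * ρ₀) (j := 0) (D := D)
      hx'0 hy hθ₀ hDnn (fun k => le_of_eq (hDs k)) hD0 hsmallE hsmallG i (Nat.zero_le i)
    linarith [h]

end Envelope

end Summit.QuantumFields.YangMills.Theorems.UV3BranchExpansionCountingRecursion

end
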